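import Mathlib.Data.Real.Basic
import Mathlib.Tactic.Linarith
import Mathlib.Tactic.Ring
import Mathlib.Tactic.Positivity
import Mathlib.Tactic.FieldSimp
import HarnessLib

/-!
# Two-cuts with the root and one target on the root side (MODE B), III: the near lemma — real algebra of the merged-target identity

Support file for the Sahi programme (`--supports stmt-CriticalPhenomena-4575`, prover prim-sahi-p2 gen 26).  No definitions, no named
facts, no sorries; standard axioms.  Memo `run/shared/lean/prim/prim-sahi/FROM-prim-sahi-p2-gen26-NEAR-LEMMA.md` §3–§4.

**Setting** (as in parts I–II, `IncStarTwoCut.twoCut_Apart_nonneg`).  A two-separator `{x, y}` not containing the root `s`; the near side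
`N` contains `s` and the lone target `a`.  All probabilities below are real numbers attached to events of `N`:
classes of the root's port connectivity `0′, X, Y, XY` with law `(q₀, qX, qY, w)`, `x̄ = qX + w`, `ȳ = qY + w`;
`A = {a ∈ C_s}` with class vector `(a₀, aX, aY, aXY)` and mass `α`; the "separated attachments"
`E_x = {a ∈ C_x, x ↮ s, x ↮ y}` (mass `ex`), `E_y` (mass `ey`), `E_xy = {a ∈ C_x, x ↔ y, x ↮ s}` (mass `exy`), whose union
`E′ = E_x ⊔ E_y ⊔ E_xy = {a ∈ (C_x ∪ C_y) ∖ C_s}` is disjoint from `A`, and the MERGED TARGET `M′ = A ⊔ E′ = {a ∈ C_s ∪ C_x ∪ C_y}`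
(an increasing event, mass `pM = α + ex + ey + exy`); `D_x = {x ↮ s, x ↮ y}` (mass `pDx`), `Z = {x ↔ y, x ↮ s}` (mass `pZ`), so that
`x̄ + pDx + pZ = 1`; `τx = ex / pDx`, `τy = ey / pDy` (the conditional attachment probabilities of the memo).
For a port event `J ∈ {X̂, Ŷ, Û, Ŵ}` we write `pJ = P(J)`, `pAJ = P(A ∩ J)`, `pMJ = P(M′ ∩ J)`, `cXJ = Cov(X̂, J)`, `cYJ = Cov(Ŷ, J)`,
`pJDx = P(J ∩ D_x)`, `pExJ = P(E_x ∩ J)` (and `y`-mirrors); for these four `J` one has `J ∩ Z = ∅` and `J ∩ E_xy = ∅`, whence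
`pAJ = pMJ − pExJ − pEyJ` and `cXJ + pJDx = (1 − x̄)·pJ` (because `X̂ ⊔ D_x ⊔ Z = Ω`).

**Content.**  (1) `near_row_identity`: the exact identity
`Cov(A,J) − τx·Cov(X̂,J) − τy·Cov(Ŷ,J) = Cov(M′,J) + (τx·pJDx − pExJ) + (τy·pJDy − pEyJ) + pJ·R₀`, `R₀ = exy − (τx + τy)·pZ`,
(2) `near_R0_identity`: `pD₀·R₀ = [exy·pD₀ − pZ·(pxaD₀ + pyaD₀)] + pZ·(pxaD₀ − τx·pD₀) + pZ·(pyaD₀ − τy·pD₀)`,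
(3) `near_row_nonneg`: the Harris row `τx·Cov(X̂,J) + τy·Cov(Ŷ,J) ≤ Cov(A,J)` from the signs of the five brackets — each bracket is, in
`N`, an instance of a theorem of the tree (Harris for `M′`; van den Berg–Häggström–Kahn Thm 1.3 in the cluster/off-cluster form
`setSep_offCluster_negCorrelation` with root `x`, avoided set `{s, y}`; and Thm 1.3 with the ROOT SET `{x, y}`,
`BHK2006_setClusterConditionalPositiveAssociation`) — see the memo §3; the probabilistic instantiation is the sequel,
(4) `near_star_row_reduction`: the STAR functional of the pseudo-law `u″ = u_A − τx·u_x − τy·u_y` equals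
`[STAR_N(a) − (2w − x̄ȳ)·P(E′)] + (2w − x̄ȳ)·R₀` (memo §4(a)), so that the STAR row follows from `R₀ ≥ 0` and the τ-free inequality (V2) of the memo,
(5) `near_V2_identity`: `STAR_N(a) − (2w − x̄ȳ)·P(E′) = Cov(Ŵ, M) + q₀·Cov(Ŵ, M′) + (qX·qY·pM − qY·aX − qX·aY)` with `M = {a ∈ C_x ∪ C_y}` (memo §4(b)).
All statements are identities / linear consequences between real numbers; every hypothesis is an equation or inequality that the events satisfy.
-/

namespace Summit.CriticalPhenomena.PercolationContinuityZ3.Theorems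

namespace IncStarTwoCut

/-- **The merged-target identity** (memo §3 Step A): for a port event `J` with `J ∩ Z = ∅ = J ∩ E_xy`,
`Cov(A,J) − τx·Cov(X̂,J) − τy·Cov(Ŷ,J) = Cov(M′,J) + (τx·pJDx − pExJ) + (τy·pJDy − pEyJ) + pJ·(exy − (τx+τy)·pZ)`. [this work] -/
theorem near_row_identity
    {pJ pAJ α cXJ cYJ pMJ pM pJDx pExJ pJDy pEyJ ex ey exy τx τy pDx pDy pZ xb yb : ℝ}
    (hA : pAJ = pMJ - pExJ - pEyJ) (hM : pM = α + ex + ey + exy)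
    (hX : cXJ = (1 - xb) * pJ - pJDx) (hY : cYJ = (1 - yb) * pJ - pJDy)
    (hex : ex = τx * pDx) (hey : ey = τy * pDy) (hDx : pDx = 1 - xb - pZ) (hDy : pDy = 1 - yb - pZ) :
    (pAJ - α * pJ) - τx * cXJ - τy * cYJ
      = (pMJ - pJ * pM) + (τx * pJDx - pExJ) + (τy * pJDy - pEyJ) + pJ * (exy - (τx + τy) * pZ) := by
  subst hA hM hX hY hex hey hDx hDy
  ring

/-- **The three brackets of `R₀`** (memo §3 Step B): with `D₀ = {x, y, s pairwise separated}` (mass `pD₀`) and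
`pxaD₀ = P(a ∈ C_x, D₀)`, `pyaD₀ = P(a ∈ C_y, D₀)`,
`pD₀·(exy − (τx+τy)·pZ) = [exy·pD₀ − pZ·(pxaD₀ + pyaD₀)] + pZ·(pxaD₀ − τx·pD₀) + pZ·(pyaD₀ − τy·pD₀)`. [this work] -/
theorem near_R0_identity (exy τx τy pZ pD0 pxaD0 pyaD0 : ℝ) :
    pD0 * (exy - (τx + τy) * pZ)
      = (exy * pD0 - pZ * (pxaD0 + pyaD0)) + pZ * (pxaD0 - τx * pD0) + pZ * (pyaD0 - τy * pD0) := by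
  ring

/-- **`R₀ ≥ 0`** from the merge bracket (`BHK2006_setClusterConditionalPositiveAssociation`, root set `{x,y}`, avoided `s`:
`pZ·(pxaD₀ + pyaD₀) ≤ exy·pD₀`) and the two off-cluster brackets (`setSep_offCluster_negCorrelation`: `τx·pD₀ ≤ pxaD₀`,
`τy·pD₀ ≤ pyaD₀`), when `pD₀ > 0` and `pZ ≥ 0`. [this work] -/
theorem near_R0_nonneg {exy τx τy pZ pD0 pxaD0 pyaD0 : ℝ} (hD0 : 0 < pD0) (hZ : 0 ≤ pZ)
    (hmerge : pZ * (pxaD0 + pyaD0) ≤ exy * pD0) (hR1x : τx * pD0 ≤ pxaD0) (hR1y : τy * pD0 ≤ pyaD0) :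
    0 ≤ exy - (τx + τy) * pZ := by
  have h := near_R0_identity exy τx τy pZ pD0 pxaD0 pyaD0
  have hsum : 0 ≤ pD0 * (exy - (τx + τy) * pZ) := by
    rw [h]
    have t1 : 0 ≤ exy * pD0 - pZ * (pxaD0 + pyaD0) := by linarith
    have t2 : 0 ≤ pZ * (pxaD0 - τx * pD0) := mul_nonneg hZ (by linarith)
    have t3 : 0 ≤ pZ * (pyaD0 - τy * pD0) := mul_nonneg hZ (by linarith)
    linarith
  have hsum' : 0 ≤ (exy - (τx + τy) * pZ) * pD0 := by rwa [mul_comm] at hsum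
  exact nonneg_of_mul_nonneg_left hsum' hD0

/-- **The Harris rows of the near lemma** (memo §3, rows (N4)–(N7)): for a port event `J ∈ {X̂, Ŷ, Û, Ŵ}`,
`τx·Cov(X̂,J) + τy·Cov(Ŷ,J) ≤ Cov(A,J)`, from the identity `near_row_identity` and the signs of its brackets:
Harris for the increasing merged target `M′` (`pJ·pM ≤ pMJ`), the off-cluster brackets (`pExJ ≤ τx·pJDx`, `pEyJ ≤ τy·pJDy`),
`R₀ ≥ 0` and `pJ ≥ 0`. [this work] -/
theorem near_row_nonneg
    {pJ pAJ α cXJ cYJ pMJ pM pJDx pExJ pJDy pEyJ ex ey exy τx τy pDx pDy pZ xb yb : ℝ}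
    (hA : pAJ = pMJ - pExJ - pEyJ) (hM : pM = α + ex + ey + exy)
    (hX : cXJ = (1 - xb) * pJ - pJDx) (hY : cYJ = (1 - yb) * pJ - pJDy)
    (hex : ex = τx * pDx) (hey : ey = τy * pDy) (hDx : pDx = 1 - xb - pZ) (hDy : pDy = 1 - yb - pZ)
    (hJ : 0 ≤ pJ) (hHarris : pJ * pM ≤ pMJ) (hfx : pExJ ≤ τx * pJDx) (hfy : pEyJ ≤ τy * pJDy)
    (hR0 : 0 ≤ exy - (τx + τy) * pZ) :
    τx * cXJ + τy * cYJ ≤ pAJ - α * pJ := by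
  have hid := near_row_identity hA hM hX hY hex hey hDx hDy
  have t4 : 0 ≤ pJ * (exy - (τx + τy) * pZ) := mul_nonneg hJ hR0
  linarith

/-- **Reduction of the STAR row** (memo §4(a)).  With `h(XY) = 2 − x̄ − ȳ − c`, `h(X) = −(ȳ + c)`, `h(Y) = −(x̄ + c)`, `h(0′) = −c`
(`c = w − x̄ȳ`) the star functional of a class vector `u` is `Σ_k u_k h(k)`; for the genuine target it is `STAR_N(a)`, for the port target
`x` (vector `(0, qX, 0, w)`) it is `(1 − x̄)(2w − x̄ȳ)`.  For `u″ = u_A − τx·u_x − τy·u_y`, with `P(E′) = ex + ey + exy`,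
`ex = τx·pDx`, `pDx = 1 − x̄ − pZ` (and mirrors):
`STAR(u″) = [STAR(u_A) − (2w − x̄ȳ)·P(E′)] + (2w − x̄ȳ)·(exy − (τx+τy)·pZ)`. [this work] -/
theorem near_star_row_reduction
    {a0 aX aY aXY qX qY w xb yb τx τy ex ey exy pDx pDy pZ : ℝ}
    (hxb : xb = qX + w) (hyb : yb = qY + w)
    (hex : ex = τx * pDx) (hey : ey = τy * pDy) (hDx : pDx = 1 - xb - pZ) (hDy : pDy = 1 - yb - pZ) :
    let c := w - xb * yb
    let star := fun (u0 uX uY uXY : ℝ) => uXY * (2 - xb - yb - c) - uX * (yb + c) - uY * (xb + c) - u0 * c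
    star a0 (aX - τx * qX) (aY - τy * qY) (aXY - (τx + τy) * w)
      = (star a0 aX aY aXY - (2 * w - xb * yb) * (ex + ey + exy)) + (2 * w - xb * yb) * (exy - (τx + τy) * pZ) := by
  simp only
  subst hex hey hDx hDy hxb hyb
  ring

/-- **The STAR row from (V2) and `R₀ ≥ 0`**: if `STAR(u_A) ≥ (2w − x̄ȳ)·P(E′)` (the τ-free inequality (V2) of the memo) and
`R₀ ≥ 0`, `2w − x̄ȳ ≥ 0`, then `STAR(u″) ≥ 0`. [this work] -/
theorem near_star_row_of_V2
    {a0 aX aY aXY qX qY w xb yb τx τy ex ey exy pDx pDy pZ : ℝ}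
    (hxb : xb = qX + w) (hyb : yb = qY + w)
    (hex : ex = τx * pDx) (hey : ey = τy * pDy) (hDx : pDx = 1 - xb - pZ) (hDy : pDy = 1 - yb - pZ)
    (htw : 0 ≤ 2 * w - xb * yb) (hR0 : 0 ≤ exy - (τx + τy) * pZ)
    (hV2 : (2 * w - xb * yb) * (ex + ey + exy)
        ≤ aXY * (2 - xb - yb - (w - xb * yb)) - aX * (yb + (w - xb * yb)) - aY * (xb + (w - xb * yb)) - a0 * (w - xb * yb)) :
    0 ≤ (aXY - (τx + τy) * w) * (2 - xb - yb - (w - xb * yb)) - (aX - τx * qX) * (yb + (w - xb * yb))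
        - (aY - τy * qY) * (xb + (w - xb * yb)) - a0 * (w - xb * yb) := by
  have h := near_star_row_reduction (a0 := a0) (aX := aX) (aY := aY) (aXY := aXY) (exy := exy) hxb hyb hex hey hDx hDy
  simp only at h
  rw [h]
  exact add_nonneg (by linarith) (mul_nonneg htw hR0)

/-- **The identity behind (V2)** (memo §4(b)): with `M = {a ∈ C_x ∪ C_y}` (mass `m`, and `P(M ∩ Ŵ) = aXY` since on `Ŵ` the events
`M` and `A` coincide), `M′ = M ⊔ (A ∩ 0′)` (mass `pM = m + a₀`) and `P(E′) = m − aX − aY − aXY`: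
`STAR(u_A) − (2w − x̄ȳ)·P(E′) = (aXY − w·m) + q₀·(aXY − w·pM) + (qX·qY·pM − qY·aX − qX·aY)`,
where `q₀ = 1 − qX − qY − w`. [this work] -/
theorem near_V2_identity
    {a0 aX aY aXY qX qY q0 w xb yb m pM pE : ℝ}
    (hxb : xb = qX + w) (hyb : yb = qY + w) (hq0 : q0 = 1 - qX - qY - w)
    (hpM : pM = m + a0) (hpE : pE = m - aX - aY - aXY) :
    (aXY * (2 - xb - yb - (w - xb * yb)) - aX * (yb + (w - xb * yb)) - aY * (xb + (w - xb * yb)) - a0 * (w - xb * yb))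
        - (2 * w - xb * yb) * pE
      = (aXY - w * m) + q0 * (aXY - w * pM) + (qX * qY * pM - qY * aX - qX * aY) := by
  subst hxb hyb hq0 hpM hpE
  ring

end IncStarTwoCut

end Summit.CriticalPhenomena.PercolationContinuityZ3.Theorems
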